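import Literature.AnabelianGeometry.EtaleTheta.SettingModelCyclotomicCharacterPadicContinuous
import HarnessLib

/-!
# The `p`-adic cyclotomic character has OPEN IMAGE on every open subgroup of `G_{ℚ_p}`:
# `χ_p(G_K) ≤ ℤ_p^×` is open of finite index for `K/ℚ_p` finite (classical; proof-only)

J.-P. Serre, *Local Fields*, IV §4 Prop. 17/18 (`Gal(ℚ_p(ζ_{p^∞})/ℚ_p) ≅ ℤ_p^×`; for a finite extension `K`,
`Gal(K(ζ_{p^∞})/K)` is an open subgroup) [cite: SerreLocalFields1979, IV §4 Prop 17]; J. Neukirch, *Algebraic Number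
Theory*, Ch. II Prop. (5.7) (i) (a `p`-adic field contains only finitely many roots of unity) [cite: NeukirchANT1999, Ch. II Prop. (5.7) (i)];
S. Mochizuki, [EtTh] §1 p. 12 "`Δ_Θ (≅ Ẑ(1))`" [cite: MochizukiEtTh2009, §1 p.12].

abc-iut cell, layer L2, seat abc-iut-w5-d091 (gen 5); χ-lineage (R78 F3), F3 addendum 7.  PROOF-ONLY (no definition, no
instance, no named fact).  F3 addendum 2 (`exists_mem_chi_ne_one_of_isOpen`) says an open `U ≤ G_{ℚ_p}` never acts trivially
through `χ`; addenda 5/6 give the continuous surjection `χ_p : G_{ℚ_p} ↠ ℤ_p^×`.  The SHARP form for open subgroups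
(e.g. `U = G_K = K.fixingSubgroup` for a finite `K/ℚ_p`, the `GK` of the χ-models):

* `finiteIndex_of_isOpen_GQp` — an open subgroup of the compact group `G_{ℚ_p}` has finite index;
* `finiteIndex_map_padicCharUnits_comp_chi` — `χ_p(U) ≤ ℤ_p^×` has finite index dividing `[G_{ℚ_p} : U]`
  (`Subgroup.index_map_dvd` along the SURJECTION `χ_p`);
* `isClosed_map_padicCharUnits_comp_chi` — `χ_p(U)` is closed (compact image under the CONTINUOUS `χ_p`);
* **`isOpen_map_padicCharUnits_comp_chi` — `χ_p(U)` is OPEN in `ℤ_p^×`** (closed of finite index); in particular it is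
  infinite and contains `1 + pⁿℤ_p` for some `n` (not spelled out here).
Classical; nothing of [EtTh] is asserted; no side is taken on [IUTchIII] Cor. 3.12; a model is consistency evidence only.
-/

noncomputable section

open CategoryTheory ProfiniteGrp ProfiniteGrp.ProfiniteCompletion

namespace Literature.AnabelianGeometry.EtaleTheta.SettingModel

open Literature.AnabelianGeometry.SemiGraphs

variable (p : ℕ) [hp : Fact p.Prime]

/-- An OPEN subgroup of `G_{ℚ_p}` has finite index (`G_{ℚ_p}` is compact; the coset space is compact and discrete).
[cite: NeukirchANT1999, Ch. IV §1] -/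
theorem finiteIndex_of_isOpen_GQp (U : Subgroup (GQp p)) (hU : IsOpen (U : Set (GQp p))) : U.FiniteIndex := by
  haveI : IsGalois ℚ_[p] (PadicAlgCl p) := {}
  haveI : DiscreteTopology (GQp p ⧸ U) := QuotientGroup.discreteTopology hU
  haveI : Finite (GQp p ⧸ U) := finite_of_compact_of_discrete
  exact Subgroup.finiteIndex_of_finite_quotient

/-- **`χ_p(U)` has finite index in `ℤ_p^×`** for every open `U ≤ G_{ℚ_p}`, and `[ℤ_p^× : χ_p(U)] ∣ [G_{ℚ_p} : U]`
(index along the surjection `χ_p`, F3 addendum 5). [cite: SerreLocalFields1979, IV §4 Prop 17] -/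
theorem index_map_padicCharUnits_comp_chi_dvd (U : Subgroup (GQp p)) :
    (U.map ((ZHatLevel.padicCharUnits p).comp (chi p))).index ∣ U.index :=
  U.index_map_dvd (padicCharUnits_comp_chi_surjective p)

/-- Finite-index form. [cite: SerreLocalFields1979, IV §4 Prop 17] -/
theorem finiteIndex_map_padicCharUnits_comp_chi (U : Subgroup (GQp p)) (hU : IsOpen (U : Set (GQp p))) :
    (U.map ((ZHatLevel.padicCharUnits p).comp (chi p))).FiniteIndex := by
  haveI := finiteIndex_of_isOpen_GQp p U hU
  refine ⟨fun h0 => ?_⟩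
  have hdvd := index_map_padicCharUnits_comp_chi_dvd p U
  rw [h0, zero_dvd_iff] at hdvd
  exact Subgroup.FiniteIndex.index_ne_zero hdvd

/-- **`χ_p(U)` is CLOSED in `ℤ_p^×`** for every closed (e.g. open) `U ≤ G_{ℚ_p}`: the continuous image of a compact set.
[cite: NeukirchANT1999, Ch. IV §1] -/
theorem isClosed_map_padicCharUnits_comp_chi (U : Subgroup (GQp p)) (hU : IsClosed (U : Set (GQp p))) :
    IsClosed ((U.map ((ZHatLevel.padicCharUnits p).comp (chi p)) : Subgroup ℤ_[p]ˣ) : Set ℤ_[p]ˣ) := by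
  haveI : IsGalois ℚ_[p] (PadicAlgCl p) := {}
  rw [Subgroup.coe_map]
  exact (hU.isCompact.image (continuous_padicCharUnits_comp_chi p)).isClosed

/-- **OPEN IMAGE: `χ_p(U)` is OPEN in `ℤ_p^×` for every open subgroup `U ≤ G_{ℚ_p}`** (closed of finite index) — e.g.
`U = G_K` for a finite extension `K/ℚ_p`: `Gal(K(ζ_{p^∞})/K) ↪ ℤ_p^×` is open. [cite: SerreLocalFields1979, IV §4 Prop 17] -/
theorem isOpen_map_padicCharUnits_comp_chi (U : Subgroup (GQp p)) (hU : IsOpen (U : Set (GQp p))) :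
    IsOpen ((U.map ((ZHatLevel.padicCharUnits p).comp (chi p)) : Subgroup ℤ_[p]ˣ) : Set ℤ_[p]ˣ) := by
  haveI := finiteIndex_map_padicCharUnits_comp_chi p U hU
  exact Subgroup.isOpen_of_isClosed_of_finiteIndex _
    (isClosed_map_padicCharUnits_comp_chi p U (Subgroup.isClosed_of_isOpen U hU))

/-- Fixing-subgroup form: for every intermediate field `K` of `ℚ̄_p/ℚ_p` with OPEN fixing subgroup `G_K` (every finite
`K/ℚ_p` — Krull topology; the χ-models' `GK`), `χ_p(G_K)` is an open subgroup of finite index of `ℤ_p^×`.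
[cite: SerreLocalFields1979, IV §4 Prop 17] -/
theorem isOpen_map_fixingSubgroup_padicCharUnits_comp_chi (K : IntermediateField ℚ_[p] (PadicAlgCl p))
    (hK : IsOpen (K.fixingSubgroup : Set (GQp p))) :
    IsOpen ((K.fixingSubgroup.map ((ZHatLevel.padicCharUnits p).comp (chi p)) : Subgroup ℤ_[p]ˣ) : Set ℤ_[p]ˣ) ∧
      (K.fixingSubgroup.map ((ZHatLevel.padicCharUnits p).comp (chi p))).FiniteIndex :=
  ⟨isOpen_map_padicCharUnits_comp_chi p _ hK, finiteIndex_map_padicCharUnits_comp_chi p _ hK⟩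

end Literature.AnabelianGeometry.EtaleTheta.SettingModel

end
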